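import Summits.QuantumFields.QCD.Theorems.PauliWegnerSeaFMClosureUnquenchedSideWitnessC1Aux7
import Summits.QuantumFields.QCD.Theorems.PauliWegnerSeaFMClosureUnquenchedSideWitnessC1Aux9
import Summits.QuantumFields.QCD.Theorems.PauliWegnerSeaFMClosureUnquenchedSideWitnessC1Aux10

/-!
# Side witness (crux `FMClosureUnquenched`, line `von-mises-circles`): `SideWitness`

Crux `Summit.QuantumFields.QCD.Theses.PauliWegnerSea.FMClosureUnquenched` (stmt-QuantumFields-11512),
line `von-mises-circles`, registered stub `stub_deterministic : LocalCofactorDomination ∧ SideWitness`: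
this file proves its SECOND conjunct as the registered sub-goal `c1_sideWitness : SideWitness`.

**Statement** (`SideWitness`, Defs): for every probe mass `m₀ ∈ [-9, 1]`, every odd torus
`(ℤ/(2S+1))⁴` and every admissible side `A` (the whole torus, an even box `ebox S x r`, or the
complement of an even box or of an odd ball, `1 ≤ r`, `r + 1 ≤ S`) there is ONE `SU(3)` lattice gauge
field `U` with `det (sideMatrix A (wilsonD U m₀)) ≠ 0`.  (With clause (AE) of `FibreBandLaw` this is
the a.e. invertibility (Tinv) of `TwoStarBounds`.)

**Proof.**  The mass restriction is not used: the witness exists for every real `m₀`, in particular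
at the free doubler masses `m₀ ∈ {0, -2, -4, -6, -8}`.
* `A = univ`: the constant diagonal twist of `TwistedFreeWilsonDirac` (Literature) has `det D_W ≠ 0`
  at every mass, and `sideMatrix univ M = M`.
* `A ≠ univ`: the *flow argument* of parts 1–10
  (`…SideWitnessC1Aux1`–`Aux10`).  A 2-in-2-out antiparallel-free sub-digraph of the nearest-neighbour
  graph of `A` (a *flow*) carries the imaginary-flux family `U_t = diag(t̄, t̄, t²)^{±1}` along /
  against the flow (`|t| = 1`); after scaling the rows of `D_A ⊕ 1` by `t` (colours `0,1`) and `t²`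
  (colour `2`) the side matrix is a polynomial matrix `M₀ + t M₁ + t² M₂ + t⁴ M₄` whose constant term,
  the *flow matrix*, is nonsingular because two distinct chiral projectors `½(1 ± γ_μ)` have
  independent ranges and trivially meeting kernels (Aux1, Aux3); a nonzero polynomial does not vanish
  on the whole unit circle (Aux2), so some `U_t` is a witness (Aux4, Aux5).  The flows: `2 × 2` tiles in
  the planes `(0,1)` and `(2,3)` on the even box (Aux7); on the complements the rules
  `y → y + e₀` / `y → y + e₁` whenever the `0`- / `1`-circle through `y` avoids the hole, completed on
  the deficit sites by tiles in the plane `(2,3)` (even hole, Aux9) or ladders in the planes `(a, 2)`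
  (odd hole, Aux10), cf. Aux6, Aux8.
-/

namespace Summit.QuantumFields.QCD.Theorems.VonMisesCirclesC1

open Matrix Literature.MathematicalPhysics.QuantumLattice Literature.Probability.LatticeModels
open Summit.QuantumFields.QCD.Theorems.VonMisesCircles Literature.MathematicalPhysics.QuantumFieldTheory

/-- The side matrix of the whole torus is the matrix itself. -/
theorem sideMatrix_univ' {N : ℕ} [NeZero N] (M : Matrix (QIdx N) (QIdx N) ℂ) :
    sideMatrix Finset.univ M = M := by
  ext p q
  simp [sideMatrix]

/-- **Side witness on the whole torus**: the constant diagonal twist of the Literature tree. -/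
theorem sideWitness_univ (S : ℕ) (m₀ : ℝ) :
    ∃ U : GaugeConfig 4 (2 * S + 1) (Matrix.specialUnitaryGroup (Fin 3) ℂ),
      (sideMatrix (Finset.univ : Finset (TorusSite 4 (2 * S + 1))) (wilsonD U m₀)).det ≠ 0 := by
  refine ⟨TwistedFreeWilson.twistCfg (2 * S + 1), ?_⟩
  rw [sideMatrix_univ']
  exact wilsonDirac_twistCfg_det_ne_zero m₀

/-- **`SideWitness`** (registered sub-goal `c1_sideWitness` of crux stmt-QuantumFields-11512, line
`von-mises-circles`; second conjunct of the registered stub `stub_deterministic`): for every probe mass,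
every odd torus and every admissible side one `SU(3)` gauge field makes the side matrix invertible. -/
theorem c1_sideWitness : SideWitness := by
  intro m₀ _ _ S A hA
  rcases hA with rfl | ⟨x, r, hr1, hr, hA⟩
  · exact sideWitness_univ S m₀
  · rcases hA with rfl | rfl | rfl
    · exact sideWitness_ebox S x r hr m₀
    · exact sideWitness_ebox_compl S x r hr m₀
    · exact sideWitness_ball_compl S x r hr1 hr m₀

end Summit.QuantumFields.QCD.Theorems.VonMisesCirclesC1
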